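import Mathlib
import Literature.Combinatorics.Optimization.TracialDesigns
import Literature.Combinatorics.Optimization.EquivariantPsdStructure
import Summits.PneNP.PneNP.Theorems.SmallBlockRothvossBallGrid

/-!
# Cell pnp-psdrank, route `ChebyshevTracialDesign`: the crux is a statement about PURE STATES — tight-orthogonal psd rectangles of
# dimension `r` are sums of `r²` orthogonal bi-representations of the tight graph by vectors of norm `≤ 1` (crux `TracialDecayExp20`,
# stmt-PneNP-19878; eng g12, MEMO-12 §4)

A PURE STRATEGY of dimension `r` is a pair of vector fields `a : t-cuts → ℝ^r`, `b : perfect matchings → ℝ^r` with `‖a_U‖, ‖b_M‖ ≤ 1`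
and `⟨a_U, b_M⟩ = 0` on the TIGHT pairs `cc(U,M) = |δ(U) ∩ M| = 1` [cite: Rothvoss2017, §2 (PDF pp. 5–6)] — an orthogonal
bi-representation of the tight bipartite graph; its kernel is `⟨a_U, b_M⟩²`. Both directions of the reduction:
* `isPsdRect_vecMulVec`, `trace_vecMulVec_mul_vecMulVec'` — a pure strategy IS a psd rectangle (`X_U = a_Ua_Uᵀ`, `Y_M = b_Mb_Mᵀ`,
  `0 ⪯ · ⪯ I`, `X_U Y_M = 0` on tight pairs) with `tr(X_U Y_M) = ⟨a_U,b_M⟩²`; hence `TracialValueLEAt W γ r` bounds every pure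
  strategy of dimension `r` by `r·γ` (`pure_le_of_tracialValueLEAt`);
* `sum_trace_eq_sum_pieces`, `pieces_orthogonal` — conversely every psd rectangle `(X, Y)` of dimension `r` is the SUM of the `r²` pure
  strategies `(√X_U e_p, √Y_M e_q)` (the tree's `EquivariantPsdStructure.sqrtRow`, [cite: FawziSaundersonParrilo2013, Thm. 4 (proof, p. 10)]):
  `tr(X_U Y_M) = Σ_{p,q} ⟨√X_U e_p, √Y_M e_q⟩²`, each piece of norm `≤ 1` and orthogonal on the tight pairs; so a bound `γ` on all pure
  strategies of dimension `r` gives `TracialValueLEAt W (r·γ) r` (`tracialValueLEAt_of_pure`).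
So, up to the factor `r` (immaterial under the budget `r²n < e^{a·dq n}`: since `r < e^{a·dq n/2}`, each direction of the reduction costs
at most a halving of the constant `a`), `TracialDecayExp20` is the statement that NO orthogonal bi-representation of the tight graph in
dimension `< e^{a dq n/2}` has design value `Σ_{U,M} W(U,M)⟨a_U,b_M⟩² > e^{−a' dq n}` — the form in which the
refuters' search space (vector fields, no matrices) and the comparison with orthogonal-representation phenomena (Lovász ϑ, Frankl–Rödl)
are stated (MEMO-12 §4). [cite: BrietDadushPokutta2014, Thm. 6 (§3)]
Stature: support/instrument (linear algebra). WHAT THIS IS NOT: no bound on any value; nothing on psd rank of `P_PM(K_n)`; no P-vs-NP content.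
-/

set_option linter.dupNamespace false -- `Summit.PneNP.PneNP.…`: summit = sub-problem (D-0017)

noncomputable section

open scoped MatrixOrder

namespace Summit.PneNP.PneNP.Theorems.ChebyshevTracialDesignPureStateReduction

open Finset Matrix Literature.Barriers.PneNP Literature.Combinatorics.Optimization
  Literature.Combinatorics.Optimization.EquivariantPsdStructure

variable {n r : ℕ}

/-! ### §1 Pure strategies are psd rectangles -/

/-- `aaᵀ` is positive semidefinite (real vectors). -/
theorem posSemidef_vecMulVec (a : Fin r → ℝ) : (vecMulVec a a).PosSemidef := by
  simpa using posSemidef_vecMulVec_self_star a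

/-- `I − aaᵀ` is positive semidefinite when `‖a‖² ≤ 1` (Cauchy–Schwarz). -/
theorem posSemidef_one_sub_vecMulVec {a : Fin r → ℝ} (ha : a ⬝ᵥ a ≤ 1) : (1 - vecMulVec a a).PosSemidef := by
  refine PosSemidef.of_dotProduct_mulVec_nonneg ?_ fun x => ?_
  · have h1 : (vecMulVec a a).IsHermitian := (posSemidef_vecMulVec a).1
    exact isHermitian_one.sub h1
  · have hx : star x = x := by ext i; simp
    rw [hx, sub_mulVec, one_mulVec, dotProduct_sub]
    have hv : x ⬝ᵥ (vecMulVec a a *ᵥ x) = (a ⬝ᵥ x) * (a ⬝ᵥ x) := by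
      rw [vecMulVec_mulVec]
      have h1 : (MulOpposite.op (a ⬝ᵥ x) • a : Fin r → ℝ) = fun i => a i * (a ⬝ᵥ x) := by
        ext i; rw [Pi.smul_apply, op_smul_eq_mul]
      have h2 : x ⬝ᵥ (fun i => a i * (a ⬝ᵥ x)) = (x ⬝ᵥ a) * (a ⬝ᵥ x) := by
        unfold dotProduct; rw [Finset.sum_mul]; exact Finset.sum_congr rfl fun i _ => by ring
      rw [h1, h2, dotProduct_comm x a]
    rw [hv]
    have hcs := SmallBlockRothvossBallGrid.dotProduct_sq_le_mul ha (le_refl (x ⬝ᵥ x))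
    nlinarith [hcs, sq_nonneg (a ⬝ᵥ x)]

/-- `tr(aaᵀ · bbᵀ) = ⟨a,b⟩²`. -/
theorem trace_vecMulVec_mul_vecMulVec' (a b : Fin r → ℝ) :
    (vecMulVec a a * vecMulVec b b).trace = (a ⬝ᵥ b) ^ 2 := by
  rw [vecMulVec_mul_vecMulVec, trace_vecMulVec, dotProduct_smul, smul_eq_mul, sq]

/-- `aaᵀ · bbᵀ = 0` when `⟨a,b⟩ = 0`. -/
theorem vecMulVec_mul_vecMulVec_eq_zero {a b : Fin r → ℝ} (h : a ⬝ᵥ b = 0) :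
    vecMulVec a a * vecMulVec b b = 0 := by
  rw [vecMulVec_mul_vecMulVec, h, zero_smul, vecMulVec_zero]

/-- **A pure strategy is a psd rectangle**: vector fields of norm `≤ 1`, orthogonal on the tight pairs, give `IsPsdRect`. -/
theorem isPsdRect_vecMulVec (a : OddSet n → Fin r → ℝ) (b : PMatch n → Fin r → ℝ)
    (ha : ∀ U, a U ⬝ᵥ a U ≤ 1) (hb : ∀ M, b M ⬝ᵥ b M ≤ 1) (hab : ∀ U M, cc U M = 1 → a U ⬝ᵥ b M = 0) :
    IsPsdRect (fun U => vecMulVec (a U) (a U)) (fun M => vecMulVec (b M) (b M)) :=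
  ⟨fun U => ⟨posSemidef_vecMulVec _, posSemidef_one_sub_vecMulVec (ha U)⟩,
   fun M => ⟨posSemidef_vecMulVec _, posSemidef_one_sub_vecMulVec (hb M)⟩,
   fun U M h => vecMulVec_mul_vecMulVec_eq_zero (hab U M h)⟩

/-- **Tracial bound ⇒ pure bound**: `TracialValueLEAt W γ r` gives `Σ W ⟨a_U,b_M⟩² ≤ r·γ` for every pure strategy of dimension `r ≥ 1`. -/
theorem pure_le_of_tracialValueLEAt (W : OddSet n → PMatch n → ℝ) {γ : ℝ} (hr : 0 < r)
    (hW : TracialValueLEAt W γ r) (a : OddSet n → Fin r → ℝ) (b : PMatch n → Fin r → ℝ)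
    (ha : ∀ U, a U ⬝ᵥ a U ≤ 1) (hb : ∀ M, b M ⬝ᵥ b M ≤ 1) (hab : ∀ U M, cc U M = 1 → a U ⬝ᵥ b M = 0) :
    ∑ U, ∑ M, W U M * (a U ⬝ᵥ b M) ^ 2 ≤ r * γ := by
  have h := hW _ _ (isPsdRect_vecMulVec a b ha hb hab)
  simp only [trace_vecMulVec_mul_vecMulVec'] at h
  have hr' : (0 : ℝ) < r := by exact_mod_cast hr
  rwa [div_le_iff₀ hr', mul_comm] at h

/-! ### §2 Psd rectangles are sums of `r²` pure strategies -/

/-- **Square-root pieces**: `Σ W tr(X_U Y_M) = Σ_{p,q} Σ W ⟨√X_U e_p, √Y_M e_q⟩²`. -/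
theorem sum_trace_eq_sum_pieces (W : OddSet n → PMatch n → ℝ)
    {X : OddSet n → Matrix (Fin r) (Fin r) ℝ} {Y : PMatch n → Matrix (Fin r) (Fin r) ℝ} (hXY : IsPsdRect X Y) :
    ∑ U, ∑ M, W U M * (X U * Y M).trace =
      ∑ p : Fin r, ∑ q : Fin r, ∑ U, ∑ M, W U M * (sqrtRow (X U) p ⬝ᵥ sqrtRow (Y M) q) ^ 2 := by
  calc ∑ U, ∑ M, W U M * (X U * Y M).trace
      = ∑ U, ∑ M, ∑ p : Fin r, ∑ q : Fin r, W U M * (sqrtRow (X U) p ⬝ᵥ sqrtRow (Y M) q) ^ 2 := by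
        refine sum_congr rfl fun U _ => sum_congr rfl fun M _ => ?_
        rw [trace_mul_eq_sum_sq_sqrtRow (hXY.1 U).1 (hXY.2.1 M).1, mul_sum]
        exact sum_congr rfl fun p _ => by rw [mul_sum]
    _ = ∑ U, ∑ p : Fin r, ∑ M, ∑ q : Fin r, W U M * (sqrtRow (X U) p ⬝ᵥ sqrtRow (Y M) q) ^ 2 :=
        sum_congr rfl fun U _ => sum_comm
    _ = ∑ p : Fin r, ∑ U, ∑ M, ∑ q : Fin r, W U M * (sqrtRow (X U) p ⬝ᵥ sqrtRow (Y M) q) ^ 2 := sum_comm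
    _ = ∑ p : Fin r, ∑ U, ∑ q : Fin r, ∑ M, W U M * (sqrtRow (X U) p ⬝ᵥ sqrtRow (Y M) q) ^ 2 :=
        sum_congr rfl fun p _ => sum_congr rfl fun U _ => sum_comm
    _ = ∑ p : Fin r, ∑ q : Fin r, ∑ U, ∑ M, W U M * (sqrtRow (X U) p ⬝ᵥ sqrtRow (Y M) q) ^ 2 :=
        sum_congr rfl fun p _ => sum_comm

/-- The pieces have norm `≤ 1` … -/
theorem piece_norm_le_one {X : OddSet n → Matrix (Fin r) (Fin r) ℝ} {Y : PMatch n → Matrix (Fin r) (Fin r) ℝ}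
    (hXY : IsPsdRect X Y) (p : Fin r) (U : OddSet n) : sqrtRow (X U) p ⬝ᵥ sqrtRow (X U) p ≤ 1 :=
  sqrtRow_sq_le_one (hXY.1 U).1 (hXY.1 U).2 p

/-- … on the matching side too … -/
theorem piece_norm_le_one' {X : OddSet n → Matrix (Fin r) (Fin r) ℝ} {Y : PMatch n → Matrix (Fin r) (Fin r) ℝ}
    (hXY : IsPsdRect X Y) (q : Fin r) (M : PMatch n) : sqrtRow (Y M) q ⬝ᵥ sqrtRow (Y M) q ≤ 1 :=
  sqrtRow_sq_le_one (hXY.2.1 M).1 (hXY.2.1 M).2 q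

/-- … and are orthogonal on the tight pairs (`tr(X_U Y_M) = 0` is a sum of squares). -/
theorem pieces_orthogonal {X : OddSet n → Matrix (Fin r) (Fin r) ℝ} {Y : PMatch n → Matrix (Fin r) (Fin r) ℝ}
    (hXY : IsPsdRect X Y) (p q : Fin r) (U : OddSet n) (M : PMatch n) (h : cc U M = 1) :
    sqrtRow (X U) p ⬝ᵥ sqrtRow (Y M) q = 0 := by
  have h0 : ∑ p' : Fin r, ∑ q' : Fin r, (sqrtRow (X U) p' ⬝ᵥ sqrtRow (Y M) q') ^ 2 = 0 := by
    rw [← trace_mul_eq_sum_sq_sqrtRow (hXY.1 U).1 (hXY.2.1 M).1, hXY.2.2 U M h, trace_zero]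
  have h1 := (sum_eq_zero_iff_of_nonneg fun p' _ => sum_nonneg fun q' _ => sq_nonneg _).1 h0 p (mem_univ _)
  have h2 := (sum_eq_zero_iff_of_nonneg fun q' _ => sq_nonneg (sqrtRow (X U) p ⬝ᵥ sqrtRow (Y M) q')).1 h1 q (mem_univ _)
  exact pow_eq_zero_iff two_ne_zero |>.1 h2

/-- **Pure bound ⇒ tracial bound.** If every pure strategy of dimension `r` (vector fields of norm `≤ 1`, orthogonal on the tight
pairs) has `Σ W ⟨a_U,b_M⟩² ≤ γ`, then every psd rectangle of dimension `r` has `Σ W tr(X_U Y_M) ≤ r²·γ`. -/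
theorem sum_trace_le_of_pure (W : OddSet n → PMatch n → ℝ) {γ : ℝ}
    (hpure : ∀ (a : OddSet n → Fin r → ℝ) (b : PMatch n → Fin r → ℝ),
      (∀ U, a U ⬝ᵥ a U ≤ 1) → (∀ M, b M ⬝ᵥ b M ≤ 1) → (∀ U M, cc U M = 1 → a U ⬝ᵥ b M = 0) →
      ∑ U, ∑ M, W U M * (a U ⬝ᵥ b M) ^ 2 ≤ γ)
    {X : OddSet n → Matrix (Fin r) (Fin r) ℝ} {Y : PMatch n → Matrix (Fin r) (Fin r) ℝ} (hXY : IsPsdRect X Y) :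
    ∑ U, ∑ M, W U M * (X U * Y M).trace ≤ (r : ℝ) ^ 2 * γ := by
  rw [sum_trace_eq_sum_pieces W hXY]
  have hle : ∀ p q : Fin r, ∑ U, ∑ M, W U M * (sqrtRow (X U) p ⬝ᵥ sqrtRow (Y M) q) ^ 2 ≤ γ :=
    fun p q => hpure _ _ (piece_norm_le_one hXY p) (piece_norm_le_one' hXY q)
      (fun U M h => pieces_orthogonal hXY p q U M h)
  calc ∑ p : Fin r, ∑ q : Fin r, ∑ U, ∑ M, W U M * (sqrtRow (X U) p ⬝ᵥ sqrtRow (Y M) q) ^ 2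
      ≤ ∑ _p : Fin r, ∑ _q : Fin r, γ := sum_le_sum fun p _ => sum_le_sum fun q _ => hle p q
    _ = (r : ℝ) ^ 2 * γ := by
        rw [sum_const, sum_const, card_univ, Fintype.card_fin, smul_smul, nsmul_eq_mul]; push_cast; ring

/-- **Packaged**: a bound `γ` on all pure strategies of dimension `r` gives `TracialValueLEAt W (r·γ) r`. -/
theorem tracialValueLEAt_of_pure (W : OddSet n → PMatch n → ℝ) {γ : ℝ}
    (hpure : ∀ (a : OddSet n → Fin r → ℝ) (b : PMatch n → Fin r → ℝ),
      (∀ U, a U ⬝ᵥ a U ≤ 1) → (∀ M, b M ⬝ᵥ b M ≤ 1) → (∀ U M, cc U M = 1 → a U ⬝ᵥ b M = 0) →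
      ∑ U, ∑ M, W U M * (a U ⬝ᵥ b M) ^ 2 ≤ γ) :
    TracialValueLEAt W (r * γ) r := by
  intro X Y hXY
  have h := sum_trace_le_of_pure W hpure hXY
  rcases Nat.eq_zero_or_pos r with hr | hr
  · subst hr; simp
  · have hr' : (0 : ℝ) < r := by exact_mod_cast hr
    rw [div_le_iff₀ hr']
    calc ∑ U, ∑ M, W U M * (X U * Y M).trace ≤ (r : ℝ) ^ 2 * γ := h
      _ = r * γ * r := by ring

end Summit.PneNP.PneNP.Theorems.ChebyshevTracialDesignPureStateReduction

end
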